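import Literature.MathematicalPhysics.QuantumFieldTheory.Balaban1983to89.Beta.WilsonWardColumns2

/-!
# The order-`B²` Ward identity of the Wilson plaquette jets, second order in `W`, ALL LETTERS (`λ` at all four corners)

HONEST FRAMING (cell `pub-balaban`, β sub-cell, lineage an3; verbatim): discharging `BetaPertH` makes Bałaban's UV stability
UNCONDITIONAL — a real constructive-QFT result; it is NOT the continuum limit and NOT the Clay problem.  This file discharges NOTHING
of `BetaPertH`.  ABSOLUTE RULE of the cell (verbatim): «No internally-minted statement may enter as a cited fact. Every hypothesis is
either kernel-proved in this package or a verbatim quotation of a PUBLISHED theorem with page reference. The manuscript(s) under audit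
are NOT citable for their own disputed steps — they are the thing under adjudication; programme-internal (2001/route/tribunal) claims
are never citable.»  Accordingly every declaration below is kernel-proved here from the imports; NOTHING is cited; no `def … : Prop`
occurs at all (no `def` at all).

## What is proved

Fifth file of the Ward series of the Wilson plaquette jets (`Beta.WilsonWardJets`: orders `B⁰`, `B¹`, all letters;
`Beta.WilsonWardJets2`: order `B²` first order in `W`, all letters, + the integer closed forms; `Beta.WilsonWardEntries2` /
`Beta.WilsonWardColumns2`: order `B²` second order in `W`, the sixteen ENTRIES and the four COLUMNS; read their headers for the
setting: the chart `U_b = e^{W_b}·e^{B_b}` of [Balaban1985BackgroundPropagators] (3.1) p. 390 = `Beta.WilsonVertex.plaq`, corners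
`x₁ → x₂ → x₃ ← x₄ ← x₁`, bonds `b₁ : x₁ → x₂`, `b₂ : x₂ → x₃`, `b₃ : x₄ → x₃`, `b₄ : x₁ → x₄`, jets `F_{2,2} = τ∘P22`, `F_{2,1} = τ∘P21`,
`F_{2,0} = τ∘quad∘wpart`, `F_{1,2} = τ∘P12`, `F_{1,1} = τ∘P11`).  THIS FILE CLOSES THE SERIES AT ORDER `B²`: the identity

  `4·Pol F_{2,2}(h, W₀λ) + 4·Pol F_{2,1}(h, W₁(B)λ) + 2·Pol F_{2,0}(h, 2W₂(B)λ) = 2·F_{1,2}(N₀(h)λ) + 2·F_{1,1}(N₁(h)λ)`     (E₂)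

(`Pol f(h,v) = f(h+v) − f(h) − f(v)`) is proved with the GAUGE PARAMETER `λ = (l₁, l₂, l₃, l₄)` AT ALL FOUR CORNERS AT ONCE and the
connection variation `h = (h₁, h₂, h₃, h₄)` arbitrary on the four bonds (`ward22`, §3), for EVERY ring `𝔸`, every `𝕜`-linear TRACIAL
`τ` (hypothesis `hτ`), all letters `B₁, …, B₄, h₁, …, h₄, l₁, …, l₄`.  Letters, bond by bond (`λ(b₋)`, `λ(b₊)` = the parameter at the
start / end of `b`): `W₀λ_b = λ(b₋) − λ(b₊)`, i.e. `W₀λ = (l₁ − l₂, l₂ − l₃, l₄ − l₃, l₁ − l₄)`; `W₁(B)λ_b = λ(b₊)·B_b − B_b·λ(b₊)`;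
`2W₂(B)λ_b = B_b·(W₁(B)λ_b) − (W₁(B)λ_b)·B_b`; `N₀(h)λ_b = (h_b·λ(b₋) − λ(b₋)·h_b) + (h_b·λ(b₊) − λ(b₊)·h_b)`;
`N₁(h)λ_b = (W₁(B)λ_b)·h_b − h_b·(W₁(B)λ_b)`.  Setting three of the `l_k` to `0` returns, letter for letter, the four columns
`WilsonWardColumns2.ward22_x{k}` (checked in the free algebra by the archived engine `code/ward22_check.py`, which also evaluates
(E₂) as transcribed here with `τ = tr` on random integer matrices in exact arithmetic: `0` failures, left side generically `≠ 0`).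

On the way, and of independent use (they are what lets hypothesis (I1) of `Beta.LagrangianGaugeDegeneracy` be READ AS MATRICES for
these jets — a bilinear Hessian block `S₂` against a gauge direction linear in `λ`), §2 proves the W-DEGREE STRUCTURE of the
plaquette jets with NO trace and ALL letters: `P22 ∘ plaq`, `P21 ∘ plaq`, `quad ∘ wpart ∘ plaq` are W-QUADRATIC — their third
difference in the W-quadruple vanishes identically (`P22_plaq_polar₃`, `P21_plaq_polar₃`, `quad_wpart_plaq_polar₃`; hence their
polar forms `Pol` are additive in each argument, `polar_add`) — and `P12 ∘ plaq`, `P11 ∘ plaq` are W-ADDITIVE (`P12_plaq_add`,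
`P11_plaq_add`); all five vanish at `W = 0` (`…_plaq_zero`).  §1 is generic bookkeeping in an abelian group: `polar_add`,
`polar_sum₄`, `add_sum₄`, and `ward_sum₄` = «four columns + polar additivity ⇒ the identity at the summed arguments».

METHOD.  No fifth commutator certificate: the one-shot all-letters certificate exceeds the normaliser's budget (recorded in
`Beta.WilsonWardJets2`'s header; the remark in `Beta.WilsonWardColumns2`'s header «NOT restated as a theorem» is superseded by this
file).  Instead STRUCTURE: the degree lemmas of §2 are ring identities that hold monomial by monomial (every monomial of `P22`, `P21`,
`quad∘wpart` carries exactly two W-letters, of `P12`, `P11` exactly one), proved by unfolding the definitional recursions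
(`WilsonVertex2.P22_consW/B`, `WilsonVertex.P21/P12/P11_consW/B`, `TransportVertices.quad_cons`) and `noncomm_ring`, with the scalar
`(2:𝕜)⁻¹ •` of the recursions read as left multiplication by `algebraMap 𝕜 𝔸 2⁻¹` (`Algebra.smul_def`) — an ordinary letter for the
normaliser (sizes: 100 / 40 / 10 / 40 / 16 monomials per jet; `maxHeartbeats` raised for `P22` only); then `ward22` = `ward_sum₄` over
`𝔸 × 𝔸 × 𝔸 × 𝔸` fed with the four columns `ward22_x1 … x4` BY NAME, the corner-`x₁` column completed by the `…_plaq_zero` lemmas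
(no bond ends at `x₁`: its `W₁`, `W₂`, `N₁` groups vanish), and `simp only` bookkeeping of the quadruple sums.  The kernel re-verifies
everything and trusts nothing; the archived engine is a records-level second reading of the statement, not an input.

## Why (dictionary to `Beta.LagrangianGaugeDegeneracy`, hypothesis (I1), order `B²`)

`Beta.WilsonWardJets` §Why gives the graded reading `Σ_{j+k=n} 2·Pol F_{2,j}(h, W_kλ) = Σ_{j+k=n} F_{1,j}(N_k(h)λ)` of (I1) for the
Wilson jets; `n = 0, 1` are `WilsonWardJets.ward20` / `ward21` (all letters); (E₂) is TWICE the `n = 2` reading (the `½` of `W₂`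
cleared; `F_{1,0}(N₂λ) = 0` dropped: `WilsonWardJets.trace_wsum_plaq_comm`), now also ALL LETTERS.  With `ward20`, `ward21`, `ward22`
the identity half of (I1) for the Wilson plaquette jets is in the kernel through order `B²` in the form a lattice sum consumes
(one plaquette, arbitrary `h`, arbitrary site parameters at its four corners); the MATRIX BOOKKEEPING of (I1) itself (assembling
`S₂`, `N`, `s₁` over the lattice from these per-plaquette forms) is not done here — §2 supplies the bilinearity it needs.
PROVENANCE (not used in proofs): invariance of `τ(U(∂p))` under `U_b ↦ u(x_{b₋}) U_b u(x_{b₊})⁻¹`, `u = e^{λ}`, second variation,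
`B`-degree two.

## What this file does NOT do

Nothing at order `B³` or higher; nothing about the minimiser manifold, the hypotheses (K2), (L) of `Beta.LagrangianGaugeDegeneracy`,
(c1)–(c3) of `Beta.GaugeFixing`, the lattice-summed matrix form of (I1), or any estimate; it moves no wall statement; it is not summit
progress, not the continuum limit, not Clay.  [folklore] throughout: multilinear algebra in an arbitrary normed algebra.
-/

namespace Literature.MathematicalPhysics.QuantumFieldTheory.Balaban1983to89.Beta.WilsonWard22

open Literature.MathematicalPhysics.QuantumFieldTheory.Balaban1983to89.Beta.TransportVertices
open Literature.MathematicalPhysics.QuantumFieldTheory.Balaban1983to89.Beta.WilsonVertex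
open Literature.MathematicalPhysics.QuantumFieldTheory.Balaban1983to89.Beta.WilsonVertex2
open Literature.MathematicalPhysics.QuantumFieldTheory.Balaban1983to89.Beta.WilsonWardColumns2
  (ward22_x1 ward22_x2 ward22_x3 ward22_x4)

/-! ## §1 Polar bookkeeping in an abelian group (generic; no ring, no trace) -/

section Polar

variable {G H : Type*} [AddCommGroup G] [AddCommGroup H]

/-- If the third difference of `F : G → H` vanishes identically (`F` «quadratic»), the polar form
`(h, v) ↦ F (h + v) − F h − F v` is additive in `v`. [folklore] -/
theorem polar_add (F : G → H)
    (hF : ∀ x y z : G, F (x + y + z) - F (x + y) - F (x + z) - F (y + z) + F x + F y + F z = 0) (h x y : G) :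
    F (h + (x + y)) - F h - F (x + y) = F (h + x) - F h - F x + (F (h + y) - F h - F y) := by
  have e := hF h x y
  rw [← add_assoc]
  calc F (h + x + y) - F h - F (x + y)
      = (F (h + x + y) - F (h + x) - F (h + y) - F (x + y) + F h + F x + F y)
          + (F (h + x) - F h - F x + (F (h + y) - F h - F y)) := by abel
    _ = F (h + x) - F h - F x + (F (h + y) - F h - F y) := by rw [e, zero_add]

/-- Four-fold additivity of the polar form of a «quadratic» `F` (`polar_add` iterated). [folklore] -/
theorem polar_sum₄ (F : G → H)
    (hF : ∀ x y z : G, F (x + y + z) - F (x + y) - F (x + z) - F (y + z) + F x + F y + F z = 0)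
    (h x y z w : G) :
    F (h + (x + y + z + w)) - F h - F (x + y + z + w) =
      F (h + x) - F h - F x + (F (h + y) - F h - F y) + (F (h + z) - F h - F z) + (F (h + w) - F h - F w) := by
  rw [polar_add F hF h (x + y + z) w, polar_add F hF h (x + y) z, polar_add F hF h x y]

/-- Four-fold additivity of an additive `D : G → H`. [folklore] -/
theorem add_sum₄ (D : G → H) (hD : ∀ x y : G, D (x + y) = D x + D y) (x y z w : G) :
    D (x + y + z + w) = D x + D y + D z + D w := by
  rw [hD, hD, hD]

/-- **COLUMNS ⇒ ALL LETTERS (generic).**  Three «quadratic» functionals `A`, `B`, `C` (third differences vanish), two additive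
ones `D`, `E`; if the identity `Pol A(h, aₖ) + Pol B(h, bₖ) + Pol C(h, cₖ) = D nₖ + E mₖ` holds for each of four columns
`k = 1, …, 4`, it holds for the sums `Σₖ aₖ, Σₖ bₖ, Σₖ cₖ, Σₖ nₖ, Σₖ mₖ`. [folklore] -/
theorem ward_sum₄ (A B C D E : G → H)
    (hA : ∀ x y z : G, A (x + y + z) - A (x + y) - A (x + z) - A (y + z) + A x + A y + A z = 0)
    (hB : ∀ x y z : G, B (x + y + z) - B (x + y) - B (x + z) - B (y + z) + B x + B y + B z = 0)
    (hC : ∀ x y z : G, C (x + y + z) - C (x + y) - C (x + z) - C (y + z) + C x + C y + C z = 0)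
    (hD : ∀ x y : G, D (x + y) = D x + D y) (hE : ∀ x y : G, E (x + y) = E x + E y)
    (h a₁ a₂ a₃ a₄ b₁ b₂ b₃ b₄ c₁ c₂ c₃ c₄ n₁ n₂ n₃ n₄ m₁ m₂ m₃ m₄ : G)
    (col₁ : A (h + a₁) - A h - A a₁ + (B (h + b₁) - B h - B b₁) + (C (h + c₁) - C h - C c₁) = D n₁ + E m₁)
    (col₂ : A (h + a₂) - A h - A a₂ + (B (h + b₂) - B h - B b₂) + (C (h + c₂) - C h - C c₂) = D n₂ + E m₂)
    (col₃ : A (h + a₃) - A h - A a₃ + (B (h + b₃) - B h - B b₃) + (C (h + c₃) - C h - C c₃) = D n₃ + E m₃)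
    (col₄ : A (h + a₄) - A h - A a₄ + (B (h + b₄) - B h - B b₄) + (C (h + c₄) - C h - C c₄) = D n₄ + E m₄) :
    A (h + (a₁ + a₂ + a₃ + a₄)) - A h - A (a₁ + a₂ + a₃ + a₄)
        + (B (h + (b₁ + b₂ + b₃ + b₄)) - B h - B (b₁ + b₂ + b₃ + b₄))
        + (C (h + (c₁ + c₂ + c₃ + c₄)) - C h - C (c₁ + c₂ + c₃ + c₄)) =
      D (n₁ + n₂ + n₃ + n₄) + E (m₁ + m₂ + m₃ + m₄) := by
  rw [polar_sum₄ A hA h a₁ a₂ a₃ a₄, polar_sum₄ B hB h b₁ b₂ b₃ b₄, polar_sum₄ C hC h c₁ c₂ c₃ c₄,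
    add_sum₄ D hD n₁ n₂ n₃ n₄, add_sum₄ E hE m₁ m₂ m₃ m₄]
  calc _ = (A (h + a₁) - A h - A a₁ + (B (h + b₁) - B h - B b₁) + (C (h + c₁) - C h - C c₁))
        + (A (h + a₂) - A h - A a₂ + (B (h + b₂) - B h - B b₂) + (C (h + c₂) - C h - C c₂))
        + (A (h + a₃) - A h - A a₃ + (B (h + b₃) - B h - B b₃) + (C (h + c₃) - C h - C c₃))
        + (A (h + a₄) - A h - A a₄ + (B (h + b₄) - B h - B b₄) + (C (h + c₄) - C h - C c₄)) := by abel
    _ = (D n₁ + E m₁) + (D n₂ + E m₂) + (D n₃ + E m₃) + (D n₄ + E m₄) := by rw [col₁, col₂, col₃, col₄]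
    _ = _ := by abel

end Polar

/-! ## §2 W-degree of the plaquette jets: `P22`, `P21`, `quad ∘ wpart` are W-quadratic, `P12`, `P11` W-additive (all letters, no trace) -/

section Degree

variable (𝕜 : Type*) [RCLike 𝕜] {𝔸 : Type*} [NormedRing 𝔸] [NormedAlgebra 𝕜 𝔸]
variable (B₁ B₂ B₃ B₄ : 𝔸)

set_option maxHeartbeats 4000000 in
/-- **`P22 ∘ plaq` IS W-QUADRATIC**: its third difference in the W-quadruple vanishes identically (every monomial of the
`(2,2)`-component carries exactly two W-letters), for all letters, in every ring. [folklore] -/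
theorem P22_plaq_polar₃ (x₁ x₂ x₃ x₄ y₁ y₂ y₃ y₄ z₁ z₂ z₃ z₄ : 𝔸) :
    P22 𝕜 (plaq (x₁ + y₁ + z₁) (x₂ + y₂ + z₂) (x₃ + y₃ + z₃) (x₄ + y₄ + z₄) B₁ B₂ B₃ B₄)
      - P22 𝕜 (plaq (x₁ + y₁) (x₂ + y₂) (x₃ + y₃) (x₄ + y₄) B₁ B₂ B₃ B₄)
      - P22 𝕜 (plaq (x₁ + z₁) (x₂ + z₂) (x₃ + z₃) (x₄ + z₄) B₁ B₂ B₃ B₄)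
      - P22 𝕜 (plaq (y₁ + z₁) (y₂ + z₂) (y₃ + z₃) (y₄ + z₄) B₁ B₂ B₃ B₄)
      + P22 𝕜 (plaq x₁ x₂ x₃ x₄ B₁ B₂ B₃ B₄) + P22 𝕜 (plaq y₁ y₂ y₃ y₄ B₁ B₂ B₃ B₄)
      + P22 𝕜 (plaq z₁ z₂ z₃ z₄ B₁ B₂ B₃ B₄) = 0 := by
  simp only [plaq, P22_consW, P22_consB, P22_nil, P21_consW, P21_consB, P21_nil, P12_consW, P12_consB, P12_nil,
    P11_consW, P11_consB, P11_nil, quad_cons, quad_nil, wpart_consW, wpart_consB, wpart_nil, bpart_consW, bpart_consB,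
    bpart_nil, List.sum_cons, List.sum_nil, Algebra.smul_def]
  noncomm_ring

/-- **`P21 ∘ plaq` IS W-QUADRATIC** (third W-difference vanishes identically). [folklore] -/
theorem P21_plaq_polar₃ (x₁ x₂ x₃ x₄ y₁ y₂ y₃ y₄ z₁ z₂ z₃ z₄ : 𝔸) :
    P21 𝕜 (plaq (x₁ + y₁ + z₁) (x₂ + y₂ + z₂) (x₃ + y₃ + z₃) (x₄ + y₄ + z₄) B₁ B₂ B₃ B₄)
      - P21 𝕜 (plaq (x₁ + y₁) (x₂ + y₂) (x₃ + y₃) (x₄ + y₄) B₁ B₂ B₃ B₄)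
      - P21 𝕜 (plaq (x₁ + z₁) (x₂ + z₂) (x₃ + z₃) (x₄ + z₄) B₁ B₂ B₃ B₄)
      - P21 𝕜 (plaq (y₁ + z₁) (y₂ + z₂) (y₃ + z₃) (y₄ + z₄) B₁ B₂ B₃ B₄)
      + P21 𝕜 (plaq x₁ x₂ x₃ x₄ B₁ B₂ B₃ B₄) + P21 𝕜 (plaq y₁ y₂ y₃ y₄ B₁ B₂ B₃ B₄)
      + P21 𝕜 (plaq z₁ z₂ z₃ z₄ B₁ B₂ B₃ B₄) = 0 := by
  simp only [plaq, P21_consW, P21_consB, P21_nil, P11_consW, P11_consB, P11_nil, quad_cons, quad_nil, wpart_consW,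
    wpart_consB, wpart_nil, bpart_consW, bpart_consB, bpart_nil, List.sum_cons, List.sum_nil, Algebra.smul_def]
  noncomm_ring

/-- **`quad ∘ wpart ∘ plaq` IS W-QUADRATIC** (third W-difference vanishes identically; the B-letters do not enter). [folklore] -/
theorem quad_wpart_plaq_polar₃ (x₁ x₂ x₃ x₄ y₁ y₂ y₃ y₄ z₁ z₂ z₃ z₄ : 𝔸) :
    quad 𝕜 (wpart (plaq (x₁ + y₁ + z₁) (x₂ + y₂ + z₂) (x₃ + y₃ + z₃) (x₄ + y₄ + z₄) B₁ B₂ B₃ B₄))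
      - quad 𝕜 (wpart (plaq (x₁ + y₁) (x₂ + y₂) (x₃ + y₃) (x₄ + y₄) B₁ B₂ B₃ B₄))
      - quad 𝕜 (wpart (plaq (x₁ + z₁) (x₂ + z₂) (x₃ + z₃) (x₄ + z₄) B₁ B₂ B₃ B₄))
      - quad 𝕜 (wpart (plaq (y₁ + z₁) (y₂ + z₂) (y₃ + z₃) (y₄ + z₄) B₁ B₂ B₃ B₄))
      + quad 𝕜 (wpart (plaq x₁ x₂ x₃ x₄ B₁ B₂ B₃ B₄)) + quad 𝕜 (wpart (plaq y₁ y₂ y₃ y₄ B₁ B₂ B₃ B₄))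
      + quad 𝕜 (wpart (plaq z₁ z₂ z₃ z₄ B₁ B₂ B₃ B₄)) = 0 := by
  simp only [wpart_plaq, quad_cons, quad_nil, List.sum_cons, List.sum_nil, Algebra.smul_def]
  noncomm_ring

/-- **`P12 ∘ plaq` IS W-ADDITIVE** (one W-letter per monomial). [folklore] -/
theorem P12_plaq_add (x₁ x₂ x₃ x₄ y₁ y₂ y₃ y₄ : 𝔸) :
    P12 𝕜 (plaq (x₁ + y₁) (x₂ + y₂) (x₃ + y₃) (x₄ + y₄) B₁ B₂ B₃ B₄) =
      P12 𝕜 (plaq x₁ x₂ x₃ x₄ B₁ B₂ B₃ B₄) + P12 𝕜 (plaq y₁ y₂ y₃ y₄ B₁ B₂ B₃ B₄) := by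
  simp only [plaq, P12_consW, P12_consB, P12_nil, P11_consW, P11_consB, P11_nil, quad_cons, quad_nil, wpart_consW,
    wpart_consB, wpart_nil, bpart_consW, bpart_consB, bpart_nil, List.sum_cons, List.sum_nil, Algebra.smul_def]
  noncomm_ring

omit [NormedAlgebra 𝕜 𝔸] in
/-- **`P11 ∘ plaq` IS W-ADDITIVE** (one W-letter per monomial). [folklore] -/
theorem P11_plaq_add (x₁ x₂ x₃ x₄ y₁ y₂ y₃ y₄ : 𝔸) :
    P11 (plaq (x₁ + y₁) (x₂ + y₂) (x₃ + y₃) (x₄ + y₄) B₁ B₂ B₃ B₄) =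
      P11 (plaq x₁ x₂ x₃ x₄ B₁ B₂ B₃ B₄) + P11 (plaq y₁ y₂ y₃ y₄ B₁ B₂ B₃ B₄) := by
  simp only [plaq, P11_consW, P11_consB, P11_nil, wpart_consW, wpart_consB, wpart_nil, bpart_consW, bpart_consB,
    bpart_nil, List.sum_cons, List.sum_nil]
  noncomm_ring

/-- `P22` of the plaquette word with zero W-letters vanishes. [folklore] -/
@[simp] theorem P22_plaq_zero : P22 𝕜 (plaq 0 0 0 0 B₁ B₂ B₃ B₄) = 0 := by
  simp [plaq]

/-- `P21` of the plaquette word with zero W-letters vanishes. [folklore] -/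
@[simp] theorem P21_plaq_zero : P21 𝕜 (plaq 0 0 0 0 B₁ B₂ B₃ B₄) = 0 := by
  simp [plaq]

/-- `quad ∘ wpart` of the plaquette word with zero W-letters vanishes. [folklore] -/
@[simp] theorem quad_wpart_plaq_zero : quad 𝕜 (wpart (plaq 0 0 0 0 B₁ B₂ B₃ B₄)) = 0 := by
  simp [wpart_plaq]

/-- `P12` of the plaquette word with zero W-letters vanishes. [folklore] -/
@[simp] theorem P12_plaq_zero : P12 𝕜 (plaq 0 0 0 0 B₁ B₂ B₃ B₄) = 0 := by
  simp [plaq]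

omit [NormedAlgebra 𝕜 𝔸] in
/-- `P11` of the plaquette word with zero W-letters vanishes. [folklore] -/
@[simp] theorem P11_plaq_zero : P11 (plaq 0 0 0 0 B₁ B₂ B₃ B₄) = 0 := by
  simp [plaq]

end Degree

/-! ## §3 The order-`B²` Ward identity (E₂), ALL LETTERS: `λ = (l₁, l₂, l₃, l₄)` at the four corners, `h` on the four bonds -/

section AllLetters

variable (𝕜 : Type*) [RCLike 𝕜] {𝔸 : Type*} [NormedRing 𝔸] [NormedAlgebra 𝕜 𝔸]
variable {V : Type*} [AddCommGroup V] [Module 𝕜 V]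
variable (τ : 𝔸 →ₗ[𝕜] V) (B₁ B₂ B₃ B₄ h₁ h₂ h₃ h₄ l₁ l₂ l₃ l₄ : 𝔸)

/-- **THE ORDER-`B²` WARD IDENTITY OF THE WILSON PLAQUETTE JETS, SECOND ORDER IN `W`, ALL LETTERS** (E₂):
`4·Pol F_{2,2}(h, W₀λ) + 4·Pol F_{2,1}(h, W₁(B)λ) + 2·Pol F_{2,0}(h, 2W₂(B)λ) = 2·F_{1,2}(N₀(h)λ) + 2·F_{1,1}(N₁(h)λ)` with the
gauge parameter `λ = (l₁, l₂, l₃, l₄)` at the corners `x₁, x₂, x₃, x₄` and `h = (h₁, h₂, h₃, h₄)` arbitrary on the bonds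
`b₁ : x₁ → x₂`, `b₂ : x₂ → x₃`, `b₃ : x₄ → x₃`, `b₄ : x₁ → x₄`: `W₀λ = (l₁ − l₂, l₂ − l₃, l₄ − l₃, l₁ − l₄)` (`λ(b₋) − λ(b₊)`),
`W₁(B)λ_b = λ(b₊)·B_b − B_b·λ(b₊)`, `2W₂(B)λ_b = B_b·(W₁(B)λ_b) − (W₁(B)λ_b)·B_b`, `N₀(h)λ_b = [h_b, λ(b₋)] + [h_b, λ(b₊)]`,
`N₁(h)λ_b = [W₁(B)λ_b, h_b]` — for every ring `𝔸`, every `𝕜`-linear tracial `τ`, all letters.  PROOF: the four columns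
`WilsonWardColumns2.ward22_x1 … x4` BY NAME, summed by `ward_sum₄` over `𝔸⁴`, the W-degree lemmas of §2 supplying the
additivity of every group in `λ`. [folklore] -/
theorem ward22 (hτ : ∀ a b : 𝔸, τ (a * b) = τ (b * a)) :
    (4 : 𝕜) • τ (P22 𝕜 (plaq (h₁ + (l₁ - l₂)) (h₂ + (l₂ - l₃)) (h₃ + (l₄ - l₃)) (h₄ + (l₁ - l₄)) B₁ B₂ B₃ B₄))
      - (4 : 𝕜) • τ (P22 𝕜 (plaq h₁ h₂ h₃ h₄ B₁ B₂ B₃ B₄))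
      - (4 : 𝕜) • τ (P22 𝕜 (plaq (l₁ - l₂) (l₂ - l₃) (l₄ - l₃) (l₁ - l₄) B₁ B₂ B₃ B₄))
      + ((4 : 𝕜) • τ (P21 𝕜 (plaq (h₁ + (l₂ * B₁ - B₁ * l₂)) (h₂ + (l₃ * B₂ - B₂ * l₃)) (h₃ + (l₃ * B₃ - B₃ * l₃))
            (h₄ + (l₄ * B₄ - B₄ * l₄)) B₁ B₂ B₃ B₄))
          - (4 : 𝕜) • τ (P21 𝕜 (plaq h₁ h₂ h₃ h₄ B₁ B₂ B₃ B₄))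
          - (4 : 𝕜) • τ (P21 𝕜 (plaq (l₂ * B₁ - B₁ * l₂) (l₃ * B₂ - B₂ * l₃) (l₃ * B₃ - B₃ * l₃) (l₄ * B₄ - B₄ * l₄)
            B₁ B₂ B₃ B₄)))
      + ((2 : 𝕜) • τ (quad 𝕜 (wpart (plaq (h₁ + (B₁ * (l₂ * B₁ - B₁ * l₂) - (l₂ * B₁ - B₁ * l₂) * B₁))
            (h₂ + (B₂ * (l₃ * B₂ - B₂ * l₃) - (l₃ * B₂ - B₂ * l₃) * B₂))
            (h₃ + (B₃ * (l₃ * B₃ - B₃ * l₃) - (l₃ * B₃ - B₃ * l₃) * B₃))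
            (h₄ + (B₄ * (l₄ * B₄ - B₄ * l₄) - (l₄ * B₄ - B₄ * l₄) * B₄)) B₁ B₂ B₃ B₄)))
          - (2 : 𝕜) • τ (quad 𝕜 (wpart (plaq h₁ h₂ h₃ h₄ B₁ B₂ B₃ B₄)))
          - (2 : 𝕜) • τ (quad 𝕜 (wpart (plaq (B₁ * (l₂ * B₁ - B₁ * l₂) - (l₂ * B₁ - B₁ * l₂) * B₁)
            (B₂ * (l₃ * B₂ - B₂ * l₃) - (l₃ * B₂ - B₂ * l₃) * B₂) (B₃ * (l₃ * B₃ - B₃ * l₃) - (l₃ * B₃ - B₃ * l₃) * B₃)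
            (B₄ * (l₄ * B₄ - B₄ * l₄) - (l₄ * B₄ - B₄ * l₄) * B₄) B₁ B₂ B₃ B₄)))) =
      (2 : 𝕜) • τ (P12 𝕜 (plaq (h₁ * l₁ - l₁ * h₁ + (h₁ * l₂ - l₂ * h₁)) (h₂ * l₂ - l₂ * h₂ + (h₂ * l₃ - l₃ * h₂))
          (h₃ * l₃ - l₃ * h₃ + (h₃ * l₄ - l₄ * h₃)) (h₄ * l₁ - l₁ * h₄ + (h₄ * l₄ - l₄ * h₄)) B₁ B₂ B₃ B₄))
        + (2 : 𝕜) • τ (P11 (plaq ((l₂ * B₁ - B₁ * l₂) * h₁ - h₁ * (l₂ * B₁ - B₁ * l₂))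
          ((l₃ * B₂ - B₂ * l₃) * h₂ - h₂ * (l₃ * B₂ - B₂ * l₃)) ((l₃ * B₃ - B₃ * l₃) * h₃ - h₃ * (l₃ * B₃ - B₃ * l₃))
          ((l₄ * B₄ - B₄ * l₄) * h₄ - h₄ * (l₄ * B₄ - B₄ * l₄)) B₁ B₂ B₃ B₄)) := by
  have key := ward_sum₄ (G := 𝔸 × 𝔸 × 𝔸 × 𝔸)
    (fun v => (4 : 𝕜) • τ (P22 𝕜 (plaq v.1 v.2.1 v.2.2.1 v.2.2.2 B₁ B₂ B₃ B₄)))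
    (fun v => (4 : 𝕜) • τ (P21 𝕜 (plaq v.1 v.2.1 v.2.2.1 v.2.2.2 B₁ B₂ B₃ B₄)))
    (fun v => (2 : 𝕜) • τ (quad 𝕜 (wpart (plaq v.1 v.2.1 v.2.2.1 v.2.2.2 B₁ B₂ B₃ B₄))))
    (fun v => (2 : 𝕜) • τ (P12 𝕜 (plaq v.1 v.2.1 v.2.2.1 v.2.2.2 B₁ B₂ B₃ B₄)))
    (fun v => (2 : 𝕜) • τ (P11 (plaq v.1 v.2.1 v.2.2.1 v.2.2.2 B₁ B₂ B₃ B₄)))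
    (by
      rintro ⟨x₁, x₂, x₃, x₄⟩ ⟨y₁, y₂, y₃, y₄⟩ ⟨z₁, z₂, z₃, z₄⟩
      have e := congrArg (fun a : 𝔸 => (4 : 𝕜) • τ a) (P22_plaq_polar₃ 𝕜 B₁ B₂ B₃ B₄ x₁ x₂ x₃ x₄ y₁ y₂ y₃ y₄ z₁ z₂ z₃ z₄)
      simpa only [Prod.mk_add_mk, map_add, map_sub, map_zero, smul_add, smul_sub, smul_zero] using e)
    (by
      rintro ⟨x₁, x₂, x₃, x₄⟩ ⟨y₁, y₂, y₃, y₄⟩ ⟨z₁, z₂, z₃, z₄⟩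
      have e := congrArg (fun a : 𝔸 => (4 : 𝕜) • τ a) (P21_plaq_polar₃ 𝕜 B₁ B₂ B₃ B₄ x₁ x₂ x₃ x₄ y₁ y₂ y₃ y₄ z₁ z₂ z₃ z₄)
      simpa only [Prod.mk_add_mk, map_add, map_sub, map_zero, smul_add, smul_sub, smul_zero] using e)
    (by
      rintro ⟨x₁, x₂, x₃, x₄⟩ ⟨y₁, y₂, y₃, y₄⟩ ⟨z₁, z₂, z₃, z₄⟩
      have e := congrArg (fun a : 𝔸 => (2 : 𝕜) • τ a)
        (quad_wpart_plaq_polar₃ 𝕜 B₁ B₂ B₃ B₄ x₁ x₂ x₃ x₄ y₁ y₂ y₃ y₄ z₁ z₂ z₃ z₄)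
      simpa only [Prod.mk_add_mk, map_add, map_sub, map_zero, smul_add, smul_sub, smul_zero] using e)
    (by
      rintro ⟨x₁, x₂, x₃, x₄⟩ ⟨y₁, y₂, y₃, y₄⟩
      simp only [Prod.mk_add_mk, P12_plaq_add, map_add, smul_add])
    (by
      rintro ⟨x₁, x₂, x₃, x₄⟩ ⟨y₁, y₂, y₃, y₄⟩
      simp only [Prod.mk_add_mk, P11_plaq_add, map_add, smul_add])
    (h₁, h₂, h₃, h₄)
    -- a : W₀λ, corner by corner
    (l₁, 0, 0, l₁) (-l₂, l₂, 0, 0) (0, -l₃, -l₃, 0) (0, 0, l₄, -l₄)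
    -- b : W₁(B)λ
    0 (l₂ * B₁ - B₁ * l₂, 0, 0, 0) (0, l₃ * B₂ - B₂ * l₃, l₃ * B₃ - B₃ * l₃, 0) (0, 0, 0, l₄ * B₄ - B₄ * l₄)
    -- c : 2W₂(B)λ
    0 (B₁ * (l₂ * B₁ - B₁ * l₂) - (l₂ * B₁ - B₁ * l₂) * B₁, 0, 0, 0)
    (0, B₂ * (l₃ * B₂ - B₂ * l₃) - (l₃ * B₂ - B₂ * l₃) * B₂, B₃ * (l₃ * B₃ - B₃ * l₃) - (l₃ * B₃ - B₃ * l₃) * B₃, 0)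
    (0, 0, 0, B₄ * (l₄ * B₄ - B₄ * l₄) - (l₄ * B₄ - B₄ * l₄) * B₄)
    -- n : N₀(h)λ
    (h₁ * l₁ - l₁ * h₁, 0, 0, h₄ * l₁ - l₁ * h₄) (h₁ * l₂ - l₂ * h₁, h₂ * l₂ - l₂ * h₂, 0, 0)
    (0, h₂ * l₃ - l₃ * h₂, h₃ * l₃ - l₃ * h₃, 0) (0, 0, h₃ * l₄ - l₄ * h₃, h₄ * l₄ - l₄ * h₄)
    -- m : N₁(h)λ
    0 ((l₂ * B₁ - B₁ * l₂) * h₁ - h₁ * (l₂ * B₁ - B₁ * l₂), 0, 0, 0)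
    (0, (l₃ * B₂ - B₂ * l₃) * h₂ - h₂ * (l₃ * B₂ - B₂ * l₃), (l₃ * B₃ - B₃ * l₃) * h₃ - h₃ * (l₃ * B₃ - B₃ * l₃), 0)
    (0, 0, 0, (l₄ * B₄ - B₄ * l₄) * h₄ - h₄ * (l₄ * B₄ - B₄ * l₄))
    (by
      simpa only [Prod.mk_add_mk, Prod.fst_zero, Prod.snd_zero, add_zero, zero_add, sub_self, zero_sub, sub_zero,
        neg_zero, P21_plaq_zero, quad_wpart_plaq_zero, P11_plaq_zero, map_zero, smul_zero]
        using ward22_x1 𝕜 τ B₁ B₂ B₃ B₄ h₁ h₂ h₃ h₄ l₁ hτ)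
    (by
      simpa only [Prod.mk_add_mk, add_zero, zero_add, ← sub_eq_add_neg]
        using ward22_x2 𝕜 τ B₁ B₂ B₃ B₄ h₁ h₂ h₃ h₄ l₂ hτ)
    (by
      simpa only [Prod.mk_add_mk, add_zero, zero_add, ← sub_eq_add_neg]
        using ward22_x3 𝕜 τ B₁ B₂ B₃ B₄ h₁ h₂ h₃ h₄ l₃ hτ)
    (by
      simpa only [Prod.mk_add_mk, add_zero, zero_add, ← sub_eq_add_neg]
        using ward22_x4 𝕜 τ B₁ B₂ B₃ B₄ h₁ h₂ h₃ h₄ l₄ hτ)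
  simpa only [Prod.mk_add_mk, Prod.fst_zero, Prod.snd_zero, add_zero, zero_add, zero_sub, ← sub_eq_add_neg,
    neg_add_eq_sub] using key

end AllLetters

end Literature.MathematicalPhysics.QuantumFieldTheory.Balaban1983to89.Beta.WilsonWard22
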